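import Literature.Algebra.Homology.OrderedCechPairSystemResolution
import HarnessLib

/-!
# The row hypothesis of the resolution comparison from module-level exactness (Stacks 0133, 0BEC)

Layer `Literature/Algebra/Homology` (proved lemmas only; 0 `def`, 0 named facts, no instance, no notation; pure homological algebra
over a commutative ring `A`). `Algebra/Homology/OrderedCechPairSystemResolution` compares `Tot Č•,•(P)` with the corner complex
`q ↦ Q^q ∅ ∅` of a resolution datum `ε : P ⟶ Q⁰` under the ROW hypothesis (H1′): every row
`(Čᵃ,ᵇ(P))[0] ⟶ (q ↦ Čᵃ,ᵇ(Q^q))` of `colAugment ε hε a` (a morphism of complexes in `q`, the source being the row `b` of the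
one-column bicomplex) is a quasi-isomorphism. This file discharges (H1′) from three MODULE-level conditions on the cochain modules
`Čᵃ,ᵇ = Π_τ Π_σ`, for `Q` in degrees `≥ 0`:

* `εᵃᵇ := ((Č•,•(ε)).f a).f b : Čᵃ,ᵇ(P) ⟶ Čᵃ,ᵇ(Q⁰)` is a monomorphism;
* `Čᵃ,ᵇ(P) ⟶ Čᵃ,ᵇ(Q⁰) ⟶ Čᵃ,ᵇ(Q¹)` is exact;
* the row complex `q ↦ Čᵃ,ᵇ(Q^q)` is exact in every degree `q ≥ 1`,

i.e. «`Čᵃ,ᵇ(Q•)` is a resolution of `Čᵃ,ᵇ(P)`» ⇒ **`quasiIso_colAugment_row`**. Degree `0` is Mathlib's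
`ShortComplex.quasiIso_iff_of_zeros` (all neighbouring differentials vanish: the source is concentrated in `q = 0`,
`Algebra/Homology/BicomplexSingleColumn`; the target has nothing in `q = -1`), transported along `singleObjXSelf`; the other degrees are
`quasiIsoAt_iff_exactAt` (source exact off `q = 0`). The member-wise (simplex-by-simplex) form is the sequel
`…ResolutionMemberwise`. Library only (cell `pub-hodge-ring2`, count-neutral); proves nothing about any crux, route or conjecture.
Mathlib searched (pin v4.32): `quasiIso_iff`, `quasiIsoAt_iff'`, `quasiIsoAt_iff_exactAt`, `ExactAt.of_isZero`,
`ShortComplex.quasiIso_iff_of_zeros`, `exact_and_mono_f_iff_of_iso`, `ShortComplex.isoMk` (used).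

## References

* The Stacks Project, Tag 0133 (double complexes with exact rows), Tag 0BEC. [StacksProject]
* C. A. Weibel, *An introduction to homological algebra* (1994), 2.7.3, 5.6.2. [Weibel1994]
-/

universe u

open CategoryTheory CategoryTheory.Limits HomologicalComplex

set_option backward.isDefEq.respectTransparency false

namespace Literature.Algebra.Homology

namespace OrderedCech

variable {A : Type u} [CommRing A] {ι κ : Type} [LinearOrder ι] [LinearOrder κ]
  {P : Finset ι ⥤ Finset κ ⥤ ModuleCat.{u} A} {Q : CochainComplex (Finset ι ⥤ Finset κ ⥤ ModuleCat.{u} A) ℤ}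
  (ε : P ⟶ Q.X 0) (hε : ε ≫ Q.d 0 1 = 0)

/-! ### §1 The row complexes and their differentials -/

/-- The row `b` of the column `a` of the iterated bicomplex is the complex `q ↦ Čᵃ,ᵇ(Q^q)` (`rfl`). [cite: StacksProject, Tag 0BEC] -/
theorem row_X (a b q : ℤ) :
    ((HomologicalComplex₂.flip ((cechTricomplex Q).flip.X a)).X b).X q = ModuleCat.of A (SysCochain (cochainSystem (Q.X q) a) b) := rfl

/-- Its differential is `Čᵃ,ᵇ(d_Q)` (`rfl`). [cite: StacksProject, Tag 0BEC] -/
theorem row_d (a b q q' : ℤ) :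
    ((HomologicalComplex₂.flip ((cechTricomplex Q).flip.X a)).X b).d q q' = ((sysBicomplexMap (Q.d q q')).f a).f b := rfl

include hε in
/-- `εᵃᵇ ≫ Čᵃ,ᵇ(d_Q⁰) = 0`. [cite: StacksProject, Tag 0BEC] -/
theorem eps_f_f_comp_d (a b : ℤ) :
    ((sysBicomplexMap ε).f a).f b ≫ ((sysBicomplexMap (Q.d 0 1)).f a).f b = 0 := by
  rw [← comp_f, ← comp_f, ← sysBicomplexMap_comp, hε, sysBicomplexMap_zero, zero_f, zero_f]

/-- The differentials of the rows of the one-column source vanish. [cite: Weibel1994, 1.2.6] -/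
theorem singleColumn_row_d (X : CochainComplex (ModuleCat.{u} A) ℤ) (b q q' : ℤ) :
    ((singleColumnBicomplex X).flip.X b).d q q' = 0 := by
  change ((singleColumnBicomplex X).d q q').f b = 0
  rw [singleColumnBicomplex_d, zero_f]

/-- The row complexes `q ↦ Čᵃ,ᵇ(Q^q)` have no differential into degree `0` when `Q` is in degrees `≥ 0`. [cite: Weibel1994, 1.2.6] -/
theorem row_d_neg_one_zero [Q.IsStrictlyGE 0] (a b : ℤ) : ((HomologicalComplex₂.flip ((cechTricomplex Q).flip.X a)).X b).d (-1) 0 = 0 := by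
  rw [row_d, (Q.isZero_of_isStrictlyGE 0 (-1) (by norm_num)).eq_of_src (Q.d (-1) 0) 0, sysBicomplexMap_zero, zero_f, zero_f]

/-! ### §2 The row hypothesis (H1′) from module-level exactness -/

/-- **The row `b` of `colAugment ε hε a` is a quasi-isomorphism** as soon as `εᵃᵇ` is a monomorphism, `Čᵃ,ᵇ(P) → Čᵃ,ᵇ(Q⁰) → Čᵃ,ᵇ(Q¹)`
is exact, and `q ↦ Čᵃ,ᵇ(Q^q)` is exact in degrees `≥ 1` (`Q` in degrees `≥ 0`). [cite: StacksProject, Tag 0133] [cite: Weibel1994, 2.7.3] -/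
theorem quasiIso_colAugment_row [Q.IsStrictlyGE 0] (a b : ℤ)
    (hmono : Mono (((sysBicomplexMap ε).f a).f b))
    (hex : (ShortComplex.mk (((sysBicomplexMap ε).f a).f b) (((sysBicomplexMap (Q.d 0 1)).f a).f b)
      (eps_f_f_comp_d ε hε a b)).Exact)
    (hexq : ∀ q : ℤ, 1 ≤ q → ((HomologicalComplex₂.flip ((cechTricomplex Q).flip.X a)).X b).ExactAt q) :
    QuasiIso (((HomologicalComplex₂.flipFunctor _ (ComplexShape.up ℤ) (ComplexShape.up ℤ)).map
      (colAugment ε hε a)).f b) := by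
  rw [quasiIso_iff]
  intro q
  by_cases hq : q = 0
  · subst hq
    rw [quasiIsoAt_iff' _ (-1) 0 1 (by simp) (by simp),
      ShortComplex.quasiIso_iff_of_zeros _ (singleColumn_row_d _ b (-1) 0) (singleColumn_row_d _ b 0 1)
        (row_d_neg_one_zero a b)]
    -- transport `hex`, `hmono` along `singleObjXSelf` in row `b`
    refine (ShortComplex.exact_and_mono_f_iff_of_iso ?_).1 ⟨hex, hmono⟩
    refine ShortComplex.isoMk
      ((HomologicalComplex.eval _ _ b).mapIso (singleObjXSelf (ComplexShape.up ℤ) 0 ((sysBicomplex P).X a))).symm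
      (Iso.refl _) (Iso.refl _) ?_ ?_
    · change _ ≫ ((colAugment ε hε a).f 0).f b = _ ≫ 𝟙 _
      rw [Category.comp_id, colAugment_f_zero, comp_f]
      change (singleObjXSelf (ComplexShape.up ℤ) 0 ((sysBicomplex P).X a)).inv.f b ≫
        (singleObjXSelf (ComplexShape.up ℤ) 0 ((sysBicomplex P).X a)).hom.f b ≫ _ = _
      rw [← comp_f_assoc, Iso.inv_hom_id, id_f, Category.id_comp]
    · rfl
  · -- off `q = 0` the source is exact (zero object), so quasi-iso at `q` iff the target is exact at `q`
    have hK : ((singleColumnBicomplex ((sysBicomplex P).X a)).flip.X b).ExactAt q :=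
      ExactAt.of_isZero (isZero_singleColumnBicomplex_X_X _ q hq b)
    rw [quasiIsoAt_iff_exactAt _ q hK]
    rcases lt_or_gt_of_ne hq with hlt | hgt
    · exact ExactAt.of_isZero (isZero_cechTricomplex_X_X_X Q 0 q a b hlt)
    · exact hexq q (by omega)

end OrderedCech

end Literature.Algebra.Homology
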